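/-
Copyright: the b2b-balaban T⁴-continuum CRUX team, row NE7b OWNER lineage `t4-ne7b-p1` (gen 124). Project licence.
-/
import Summits.QuantumFields.BalabanUV.T4Continuum.Spine.NE7b.SupZdPerturbedCoarseInverseLipschitz

/-!
# THE `H + K` COLUMN ON `ℤ^d`, ASSEMBLED: for `V : ℤ^d → [−λ, Λ]` (`d ≥ 3`, every mesh) and a kernel `|K(p,q)| ≤ εe^{−γ|p − q|₁}` under three
# explicit smallness conditions on `ε` with ONE set of constants `C₀, C_P, δ₀, c₁, δ₁` from `(d, a, λ, Λ)` ONLY, the objects of the perturbed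
# linear column EXIST on `ℤ^d` with no data hypotheses — the block columns `Ψ`, `Ψ^K` (equations, block-scale decay, `|Ψ^K − Ψ| = O(ε)` with
# decay, `|T_K − T| = O(ε)` with decay), the inverse `M = T⁻¹` of the coarse operator (cube limit of the section inverses, decaying, symmetric,
# `TM = 1 = MT`) and the inverse `N_K = T_K⁻¹` of the perturbed coarse operator (decaying, two-sided, `|N_K − M| = O(ε)` with decay, unique among
# decaying one-sided inverses) — (216), (194)∕(195), (219) BY NAME with their constants MERGED by `max`∕`min` through the antitonicity of
# `K_x = (2∕(1 − e^{−x}))^d`; (220)∕(221) then supply the response and the fluctuation covariance of these very objects (row NE7b, node U5c; [folklore])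

Cell `pub-balaban`, sub-cell `t4`, spine estimate NE7b (`T4WeightBudget.RelWeightBound`; the cell's OWN estimate — NOT PRINTED in
[Bałaban 1983–89], NOT PROVED).  Crux-route work under `Spine/NE7b/` by the row OWNER (`t4-ne7b-p1` gen 124, file (222)) under FREEZE
(0)'s crux-prover clause; NOTHING of Bałaban's is named as a Lean object, valued or asserted; no `T4Continuum/Support` leaf typed; no `def`,
no notation (`T`, `T_K`, `θ`, `θ_N`, `C_M′`, `C_PK_{δ₀−μ}` WRITTEN OUT); zero `sorry`; the families `Ψ`, `Ψ^K` are CHOSEN (`Classical.choice`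
through `choose`) from (216) (i)'s blockwise existence.  Imports (BY NAME): the OWNER's (219) `…SupZdPerturbedCoarseInverseLipschitz`
(`zd_perturbed_coarse_inverse_lipschitz`; through it (216) `zd_perturbed_coarse_entries`, (195) `zd_coarse_inverse_symmetric`,
`zd_coarse_mul_inverse`, `zd_coarse_inverse_mul`, (194) `zd_coarse_inverse_exists`), Mathlib's `pow_le_pow_left₀`, `inv_anti₀`.

WHY (located).  § [NE7bP1-G124-HANDOFF] NEXT (3)(a)∕(b) asked for the `H + K` column's infinite-volume objects BY NAME.  Files (213)–(221)
built them one at a time, each taking the previous objects as DATA with defining properties and each packaging its constants behind its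
own `∃` — so that downstream no two files' `C_P, δ₀` could be identified (recorded obstacle of this generation).  This file removes the
obstacle once: the constants of (216) (block columns), (219) (perturbed coarse inverse) and (194) (coarse inverse) are merged into
`C₀ = max`, `C_P = max`, `δ₀ = min`, `c₁ = max`, `δ₁ = min`; every smallness condition and every bound is MONOTONE in these (products of
nonnegative factors, and `K_x` is antitone in `x`, §1), so the merged hypotheses imply each file's hypotheses and each file's conclusions
imply the merged conclusions; the objects are then produced in order — `Ψ^K`, `Ψ` by (216) (i) (the zero kernel is in the class), `M` by
(194) on `Ψ`, `N_K` by (219) on `(Ψ, M, Ψ^K)` — and (195)'s identities and symmetry are read off for this `M`.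

WHAT IS PROVED ([folklore]): §1 `K_pos`, **`K_antitone`**; §2 **`zd_perturbed_column`** (THE END: `∃ C₀ C_P δ₀ c₁ δ₁ > 0`: for ALL `n, V, ε,
γ, μ, ν` with the three smallness conditions and every `K` of the class: `∃ Ψ Ψ^K M N` with (A) equations, decay, the two Lipschitz bounds;
(B) cube-limit property, decay, symmetry, `TM = 1 = MT`; (C) decay, `T_KN = 1 = NT_K` with summable rows, `|N − M|` bound, uniqueness on
either side); §3 toy.

HONEST (what this is NOT).  An ASSEMBLY of (194)∕(195)∕(216)∕(219) with merged constants — no new estimate; the response and covariance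
((220)∕(221)) are not restated (they apply verbatim to the objects produced here, with `C_Ψ = 2C_PK_{δ₀−μ}` and `C_u = 2C_PK_{δ₀−μ}M_f`); no
symmetry of `N_K`, no `ℓ²`, no torus → `ℤ^d` limit of the `H + K` tower; THREE smallness conditions with the sup road's constants — NOT (163)'s
energy threshold; the LINEAR column only; `d ≥ 3` only; scalar skeleton ((A3), NC-NE7b-α UNRULED); nothing of the covariant propagators of
[B4]–[B6]; nothing of Bałaban's asserted.  BY-NAME EFFECT ON THE WALL: NONE.  NE7b NOT PRINTED ∕ NOT PROVED; spine PROVED 0∕9; rung (B)+1 —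
the programme's measures remain FINITE-torus statements; NOT the mass gap, NOT Clay.  HONEST DEPENDENCY: continuum YM on T⁴ ⇐ BetaPertH ∧
nine spine estimates (0∕9 proved); BetaPertH ⇐ (D1) ∧ (D4) ∧ CAP+tail; G-an2-4 gates asym, D1 and NE2∕3∕4.
-/

set_option autoImplicit false

noncomputable section

namespace Summit.QuantumFields.BalabanUV.T4Continuum.NE7b.SupZdPerturbedColumn

open Real Filter Topology
open scoped ENNReal
open Literature.MathematicalPhysics.QuantumFieldTheory.Balaban1983to89
open B6QGQLower276 (X e blk B)
open SupZdCoarseInverse (zd_coarse_inverse_exists)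
open SupZdCoarseInverseIdentities (zd_coarse_inverse_symmetric zd_coarse_mul_inverse zd_coarse_inverse_mul)
open SupZdPerturbedCoarseEntries (zd_perturbed_coarse_entries)
open SupZdPerturbedCoarseInverseLipschitz (zd_perturbed_coarse_inverse_lipschitz)

variable {d : ℕ}

/-! ## §1. The row constant `K_x = (2∕(1 − e^{−x}))^d` is positive and antitone -/

/-- `K_x > 0` for `x > 0`. -/
theorem K_pos {x : ℝ} (hx : 0 < x) : 0 < (2 * (1 - exp (-x))⁻¹) ^ d :=
  pow_pos (mul_pos two_pos (inv_pos.2 (sub_pos.2 (exp_lt_one_iff.2 (by linarith))))) d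

/-- `K` is antitone: `0 < x ≤ y ⟹ K_y ≤ K_x`. -/
theorem K_antitone {x y : ℝ} (hx : 0 < x) (hxy : x ≤ y) : (2 * (1 - exp (-y))⁻¹) ^ d ≤ (2 * (1 - exp (-x))⁻¹) ^ d := by
  have h1 : 0 < 1 - exp (-x) := sub_pos.2 (exp_lt_one_iff.2 (by linarith))
  refine pow_le_pow_left₀ (mul_nonneg zero_le_two (inv_nonneg.2 (sub_nonneg.2 (exp_le_one_iff.2 (by linarith))))) ?_ d
  exact mul_le_mul_of_nonneg_left (inv_anti₀ h1 (sub_le_sub_left (exp_le_exp.2 (neg_le_neg hxy)) 1)) zero_le_two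

/-! ## §2. THE END: the `H + K` column on `ℤ^d`, assembled — objects constructed, one set of constants -/

/-- **HEADLINE — THE `H + K` COLUMN ON `ℤ^d`, ASSEMBLED**: `d ≥ 3`, `a > 0`, `λ < min(2,a)`, `Λ ≥ 0` ⟹ `∃ C₀ C_P δ₀ c₁ δ₁ > 0` (from
`(d, a, λ, Λ)` ONLY) such that for ALL `n`, `V : ℤ^d → [−λ, Λ]`, `ε ≥ 0`, `0 < ν < μ < min(δ₀, γ)`, `ν < δ₁`, under the three smallness
conditions on `ε` of (218)∕(219), and every kernel `|K(p,q)| ≤ εe^{−γ|p−q|₁}`, THERE EXIST (no data hypotheses) the unperturbed and perturbed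
block columns `Ψ`, `Ψ^K`, the inverse `M = T⁻¹` of the coarse operator and the inverse `N_K = T_K⁻¹` of the perturbed coarse operator on the block
lattice, with: (A) the block equations, the block-scale decay `2C_PK_{δ₀−μ}e^{−μ|blk n p − c|₁}` of both families, and the Lipschitz bounds
`|Ψ^K − Ψ| ≤ 4C_PK_{δ₀−μ}θe^{−μ|blk n p − c|₁}`, `|T_K − T| ≤ 4C_PK_{δ₀−μ}θe^{−μ|b−c|₁}` (`θ = C_PK_{δ₀−μ}εe^{μd}K_{γ−μ}`); (B) `M`: cube limit of the
section inverses, `|M(b,c)| ≤ c₁e^{−δ₁|b−c|₁}`, symmetric, `TM = 1 = MT`; (C) `N_K`: `|N_K(b,c)| ≤ 2C_M′e^{−ν|b−c|₁}` (`C_M′ = c₁e^{νd}K_{δ₁−ν}`),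
`T_KN_K = 1 = N_KT_K`, `|N_K − M| ≤ 2C_M′θ_Ne^{−ν|b−c|₁}` (`θ_N = C_M′·4C_PK_{δ₀−μ}θ·e^{νd}K_{μ−ν}`), unique among decaying one-sided inverses —
(216), (194)∕(195), (219) BY NAME, their constants MERGED by `max`∕`min` (§1: `K` is antitone).  (220)∕(221) then give the response and the
fluctuation covariance for these objects. [folklore] -/
theorem zd_perturbed_column (hd : 3 ≤ d) (a : ℝ) (ha : 0 < a) {lam Lam : ℝ} (hlam : lam < min 2 a) (hLam : 0 ≤ Lam) :
    ∃ C₀ CP δ₀ c₁ δ₁ : ℝ, 0 < C₀ ∧ 0 < CP ∧ 0 < δ₀ ∧ 0 < c₁ ∧ 0 < δ₁ ∧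
    ∀ (n : ℕ) (V : X d → ℝ), (∀ p, -lam ≤ V p) → (∀ p, V p ≤ Lam) →
    ∀ (ε γ μ ν : ℝ), 0 ≤ ε → 0 < μ → μ < δ₀ → μ < γ → 0 < ν → ν < μ → ν < δ₁ →
      ε * (2 * (1 - exp (-γ))⁻¹) ^ d * C₀ ≤ 1 / 2 →
      (CP * (2 * (1 - exp (-(δ₀ - μ)))⁻¹) ^ d) * (ε * exp (μ * d) * (2 * (1 - exp (-(γ - μ)))⁻¹) ^ d) ≤ 1 / 2 →
      (c₁ * exp (ν * d) * (2 * (1 - exp (-(δ₁ - ν)))⁻¹) ^ d)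
        * ((4 * (CP * (2 * (1 - exp (-(δ₀ - μ)))⁻¹) ^ d)
            * ((CP * (2 * (1 - exp (-(δ₀ - μ)))⁻¹) ^ d) * (ε * exp (μ * d) * (2 * (1 - exp (-(γ - μ)))⁻¹) ^ d)))
          * exp (ν * d) * (2 * (1 - exp (-(μ - ν)))⁻¹) ^ d) ≤ 1 / 2 →
    ∀ (K : X d → X d → ℝ), (∀ p q, |K p q| ≤ ε * exp (-(γ * ∑ i, (((p i - q i).natAbs : ℕ) : ℝ)))) →
    ∃ Ψ ΨK M N : X d → X d → ℝ,
      -- (A) the block columns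
      (∀ c p, ((n : ℝ) + 1) ^ 2 * ∑ μ', (2 * Ψ c p - Ψ c (p + e μ') - Ψ c (p - e μ'))
        + a / ((n : ℝ) + 1) ^ d * ∑ q ∈ B n (blk n p), Ψ c q + V p * Ψ c p = if blk n p = c then 1 else 0) ∧
      (∀ c p, |Ψ c p| ≤ 2 * (CP * (2 * (1 - exp (-(δ₀ - μ)))⁻¹) ^ d) * exp (-(μ * ∑ i, (((blk n p i - c i).natAbs : ℕ) : ℝ)))) ∧
      (∀ c p, ((n : ℝ) + 1) ^ 2 * ∑ μ', (2 * ΨK c p - ΨK c (p + e μ') - ΨK c (p - e μ'))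
        + a / ((n : ℝ) + 1) ^ d * ∑ q ∈ B n (blk n p), ΨK c q + V p * ΨK c p + ∑' q : X d, K p q * ΨK c q
          = if blk n p = c then 1 else 0) ∧
      (∀ c p, |ΨK c p| ≤ 2 * (CP * (2 * (1 - exp (-(δ₀ - μ)))⁻¹) ^ d) * exp (-(μ * ∑ i, (((blk n p i - c i).natAbs : ℕ) : ℝ)))) ∧
      (∀ c p, |ΨK c p - Ψ c p| ≤ 4 * (CP * (2 * (1 - exp (-(δ₀ - μ)))⁻¹) ^ d)
        * ((CP * (2 * (1 - exp (-(δ₀ - μ)))⁻¹) ^ d) * (ε * exp (μ * d) * (2 * (1 - exp (-(γ - μ)))⁻¹) ^ d))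
        * exp (-(μ * ∑ i, (((blk n p i - c i).natAbs : ℕ) : ℝ)))) ∧
      (∀ b c, |(((n : ℝ) + 1) ^ d)⁻¹ * ∑ q ∈ B n b, ΨK c q - (((n : ℝ) + 1) ^ d)⁻¹ * ∑ q ∈ B n b, Ψ c q|
        ≤ 4 * (CP * (2 * (1 - exp (-(δ₀ - μ)))⁻¹) ^ d)
          * ((CP * (2 * (1 - exp (-(δ₀ - μ)))⁻¹) ^ d) * (ε * exp (μ * d) * (2 * (1 - exp (-(γ - μ)))⁻¹) ^ d))
          * exp (-(μ * ∑ i, (((b i - c i).natAbs : ℕ) : ℝ)))) ∧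
      -- (B) the inverse of the coarse operator
      (∀ b b' : X d, Tendsto (fun R : ℕ =>
        if h : b ∈ (Fintype.piFinset fun _ : Fin d => Finset.Icc (-(R : ℤ)) R) ∧
            b' ∈ (Fintype.piFinset fun _ : Fin d => Finset.Icc (-(R : ℤ)) R)
          then (Matrix.of fun c c' : ↥(Fintype.piFinset fun _ : Fin d => Finset.Icc (-(R : ℤ)) R) =>
            (((n : ℝ) + 1) ^ d)⁻¹ * ∑ q ∈ B n (c : X d), Ψ (c' : X d) q)⁻¹ ⟨b, h.1⟩ ⟨b', h.2⟩ else 0)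
        atTop (𝓝 (M b b'))) ∧
      (∀ b c, |M b c| ≤ c₁ * exp (-(δ₁ * ∑ i, (((b i - c i).natAbs : ℕ) : ℝ)))) ∧
      (∀ b c, M b c = M c b) ∧
      (∀ b c, ∑' b' : X d, ((((n : ℝ) + 1) ^ d)⁻¹ * ∑ q ∈ B n b, Ψ b' q) * M b' c = if b = c then 1 else 0) ∧
      (∀ b c, ∑' b' : X d, M b b' * ((((n : ℝ) + 1) ^ d)⁻¹ * ∑ q ∈ B n b', Ψ c q) = if b = c then 1 else 0) ∧
      -- (C) the inverse of the perturbed coarse operator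
      (∀ b c, |N b c| ≤ 2 * (c₁ * exp (ν * d) * (2 * (1 - exp (-(δ₁ - ν)))⁻¹) ^ d) * exp (-(ν * ∑ i, (((b i - c i).natAbs : ℕ) : ℝ)))) ∧
      (∀ b c, Summable (fun b' : X d => ((((n : ℝ) + 1) ^ d)⁻¹ * ∑ q ∈ B n b, ΨK b' q) * N b' c) ∧
        ∑' b' : X d, ((((n : ℝ) + 1) ^ d)⁻¹ * ∑ q ∈ B n b, ΨK b' q) * N b' c = if b = c then 1 else 0) ∧
      (∀ b c, Summable (fun b' : X d => N b b' * ((((n : ℝ) + 1) ^ d)⁻¹ * ∑ q ∈ B n b', ΨK c q)) ∧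
        ∑' b' : X d, N b b' * ((((n : ℝ) + 1) ^ d)⁻¹ * ∑ q ∈ B n b', ΨK c q) = if b = c then 1 else 0) ∧
      (∀ b c, |N b c - M b c| ≤ 2 * (c₁ * exp (ν * d) * (2 * (1 - exp (-(δ₁ - ν)))⁻¹) ^ d)
        * ((c₁ * exp (ν * d) * (2 * (1 - exp (-(δ₁ - ν)))⁻¹) ^ d)
          * ((4 * (CP * (2 * (1 - exp (-(δ₀ - μ)))⁻¹) ^ d)
              * ((CP * (2 * (1 - exp (-(δ₀ - μ)))⁻¹) ^ d) * (ε * exp (μ * d) * (2 * (1 - exp (-(γ - μ)))⁻¹) ^ d)))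
            * exp (ν * d) * (2 * (1 - exp (-(μ - ν)))⁻¹) ^ d))
        * exp (-(ν * ∑ i, (((b i - c i).natAbs : ℕ) : ℝ)))) ∧
      (∀ (N' : X d → X d → ℝ) (C' ν' : ℝ), 0 ≤ C' → 0 < ν' →
        (∀ b c, |N' b c| ≤ C' * exp (-(ν' * ∑ i, (((b i - c i).natAbs : ℕ) : ℝ)))) →
        ((∀ b c, ∑' b' : X d, ((((n : ℝ) + 1) ^ d)⁻¹ * ∑ q ∈ B n b, ΨK b' q) * N' b' c = if b = c then 1 else 0) →
          ∀ b c, N' b c = N b c) ∧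
        ((∀ b c, ∑' b' : X d, N' b b' * ((((n : ℝ) + 1) ^ d)⁻¹ * ∑ q ∈ B n b', ΨK c q) = if b = c then 1 else 0) →
          ∀ b c, N' b c = N b c)) := by
  classical
  obtain ⟨C₀b, CPb, δ₀b, c₁b, δ₁b, hC₀b, hCPb, hδ₀b, hc₁b, hδ₁b, H219⟩ :=
    zd_perturbed_coarse_inverse_lipschitz (d := d) hd a ha hlam hLam
  obtain ⟨C₀c, CPc, δ₀c, hC₀c, hCPc, hδ₀c, H216⟩ := zd_perturbed_coarse_entries (d := d) hd a ha hlam hLam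
  obtain ⟨c₁d, δ₁d, hc₁d, hδ₁d, H194⟩ := zd_coarse_inverse_exists (d := d) hd a ha hlam hLam
  refine ⟨max C₀b C₀c, max CPb CPc, min δ₀b δ₀c, max c₁b c₁d, min δ₁b δ₁d, lt_max_of_lt_left hC₀b, lt_max_of_lt_left hCPb,
    lt_min hδ₀b hδ₀c, lt_max_of_lt_left hc₁b, lt_min hδ₁b hδ₁d, ?_⟩
  intro n V hV hV' ε γ μ ν hε hμ hμδ hμγ hν hνμ hνδ hsmall1 hsmall2 hsmall3 K hK
  -- the merged constants dominate each file's constants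
  have hμδb : μ < δ₀b := lt_of_lt_of_le hμδ (min_le_left _ _)
  have hμδc : μ < δ₀c := lt_of_lt_of_le hμδ (min_le_right _ _)
  have hνδb : ν < δ₁b := lt_of_lt_of_le hνδ (min_le_left _ _)
  have hK0 : 0 < (2 * (1 - exp (-(min δ₀b δ₀c - μ)))⁻¹) ^ d := K_pos (d := d) (sub_pos.2 hμδ)
  have hK0b : (2 * (1 - exp (-(δ₀b - μ)))⁻¹) ^ d ≤ (2 * (1 - exp (-(min δ₀b δ₀c - μ)))⁻¹) ^ d :=
    K_antitone (d := d) (sub_pos.2 hμδ) (sub_le_sub_right (min_le_left _ _) μ)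
  have hK0c : (2 * (1 - exp (-(δ₀c - μ)))⁻¹) ^ d ≤ (2 * (1 - exp (-(min δ₀b δ₀c - μ)))⁻¹) ^ d :=
    K_antitone (d := d) (sub_pos.2 hμδ) (sub_le_sub_right (min_le_right _ _) μ)
  have hK1 : 0 < (2 * (1 - exp (-(min δ₁b δ₁d - ν)))⁻¹) ^ d := K_pos (d := d) (sub_pos.2 hνδ)
  have hK1b : (2 * (1 - exp (-(δ₁b - ν)))⁻¹) ^ d ≤ (2 * (1 - exp (-(min δ₁b δ₁d - ν)))⁻¹) ^ d :=
    K_antitone (d := d) (sub_pos.2 hνδ) (sub_le_sub_right (min_le_left _ _) ν)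
  have hKγμ : 0 ≤ (2 * (1 - exp (-(γ - μ)))⁻¹) ^ d := (K_pos (d := d) (sub_pos.2 hμγ)).le
  have hKμν : 0 ≤ (2 * (1 - exp (-(μ - ν)))⁻¹) ^ d := (K_pos (d := d) (sub_pos.2 hνμ)).le
  have hKγ : 0 ≤ (2 * (1 - exp (-γ))⁻¹) ^ d := (K_pos (d := d) (hμ.trans hμγ)).le
  -- names for the merged and the per-file composite constants
  obtain ⟨CPK, hCPK⟩ : ∃ CPK : ℝ, CPK = max CPb CPc * (2 * (1 - exp (-(min δ₀b δ₀c - μ)))⁻¹) ^ d := ⟨_, rfl⟩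
  obtain ⟨CPKb, hCPKb⟩ : ∃ CPKb : ℝ, CPKb = CPb * (2 * (1 - exp (-(δ₀b - μ)))⁻¹) ^ d := ⟨_, rfl⟩
  obtain ⟨CPKc, hCPKc⟩ : ∃ CPKc : ℝ, CPKc = CPc * (2 * (1 - exp (-(δ₀c - μ)))⁻¹) ^ d := ⟨_, rfl⟩
  obtain ⟨Y, hY⟩ : ∃ Y : ℝ, Y = ε * exp (μ * d) * (2 * (1 - exp (-(γ - μ)))⁻¹) ^ d := ⟨_, rfl⟩
  obtain ⟨CM, hCM⟩ : ∃ CM : ℝ, CM = max c₁b c₁d * exp (ν * d) * (2 * (1 - exp (-(min δ₁b δ₁d - ν)))⁻¹) ^ d := ⟨_, rfl⟩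
  obtain ⟨CMb, hCMb⟩ : ∃ CMb : ℝ, CMb = c₁b * exp (ν * d) * (2 * (1 - exp (-(δ₁b - ν)))⁻¹) ^ d := ⟨_, rfl⟩
  have hY0 : 0 ≤ Y := by rw [hY]; positivity
  have hCPKb0 : 0 ≤ CPKb := by rw [hCPKb]; exact mul_nonneg hCPb.le (K_pos (d := d) (sub_pos.2 hμδb)).le
  have hCPKc0 : 0 ≤ CPKc := by rw [hCPKc]; exact mul_nonneg hCPc.le (K_pos (d := d) (sub_pos.2 hμδc)).le
  have hCMb0 : 0 ≤ CMb := by rw [hCMb]; exact mul_nonneg (by positivity) (K_pos (d := d) (sub_pos.2 hνδb)).le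
  have hleCPKb : CPKb ≤ CPK := by
    rw [hCPKb, hCPK]; exact mul_le_mul (le_max_left _ _) hK0b (K_pos (d := d) (sub_pos.2 hμδb)).le (by positivity)
  have hleCPKc : CPKc ≤ CPK := by
    rw [hCPKc, hCPK]; exact mul_le_mul (le_max_right _ _) hK0c (K_pos (d := d) (sub_pos.2 hμδc)).le (by positivity)
  have hleCMb : CMb ≤ CM := by
    rw [hCMb, hCM]
    exact mul_le_mul (mul_le_mul_of_nonneg_right (le_max_left _ _) (exp_pos _).le) hK1b (K_pos (d := d) (sub_pos.2 hνδb)).le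
      (by positivity)
  have hCPK0 : 0 ≤ CPK := hCPKb0.trans hleCPKb
  have hCM0 : 0 ≤ CM := hCMb0.trans hleCMb
  rw [← hY, ← hCPK] at hsmall2
  rw [← hY, ← hCPK, ← hCM] at hsmall3 ⊢
  -- each file's smallness conditions
  have hs1b : ε * (2 * (1 - exp (-γ))⁻¹) ^ d * C₀b ≤ 1 / 2 :=
    (mul_le_mul_of_nonneg_left (le_max_left C₀b C₀c) (by positivity)).trans hsmall1
  have hs1c : ε * (2 * (1 - exp (-γ))⁻¹) ^ d * C₀c ≤ 1 / 2 :=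
    (mul_le_mul_of_nonneg_left (le_max_right C₀b C₀c) (by positivity)).trans hsmall1
  have hs2b : CPKb * Y ≤ 1 / 2 := (mul_le_mul_of_nonneg_right hleCPKb hY0).trans hsmall2
  have hs2c : CPKc * Y ≤ 1 / 2 := (mul_le_mul_of_nonneg_right hleCPKc hY0).trans hsmall2
  have hηb : 4 * CPKb * (CPKb * Y) ≤ 4 * CPK * (CPK * Y) :=
    mul_le_mul (mul_le_mul_of_nonneg_left hleCPKb (by norm_num)) (mul_le_mul_of_nonneg_right hleCPKb hY0) (by positivity) (by positivity)
  have hηc : 4 * CPKc * (CPKc * Y) ≤ 4 * CPK * (CPK * Y) :=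
    mul_le_mul (mul_le_mul_of_nonneg_left hleCPKc (by norm_num)) (mul_le_mul_of_nonneg_right hleCPKc hY0) (by positivity) (by positivity)
  have hLEb : 4 * CPKb * (CPKb * Y) * exp (ν * d) * (2 * (1 - exp (-(μ - ν)))⁻¹) ^ d
      ≤ 4 * CPK * (CPK * Y) * exp (ν * d) * (2 * (1 - exp (-(μ - ν)))⁻¹) ^ d :=
    mul_le_mul_of_nonneg_right (mul_le_mul_of_nonneg_right hηb (exp_pos _).le) hKμν
  have hs3b : CMb * (4 * CPKb * (CPKb * Y) * exp (ν * d) * (2 * (1 - exp (-(μ - ν)))⁻¹) ^ d) ≤ 1 / 2 :=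
    (mul_le_mul hleCMb hLEb (by positivity) hCM0).trans hsmall3
  -- (216): the block columns (with `K` and with the zero kernel)
  have hK0cl : ∀ p q : X d, |(0 : ℝ)| ≤ ε * exp (-(γ * ∑ i, (((p i - q i).natAbs : ℕ) : ℝ))) := fun p q => by
    rw [abs_zero]; positivity
  have h216 := H216 n V hV hV' ε γ μ hε hμ hμδc hμγ hs1c (by rw [hCPKc, hY] at hs2c; exact hs2c) K hK
  have h2160 := H216 n V hV hV' ε γ μ hε hμ hμδc hμγ hs1c (by rw [hCPKc, hY] at hs2c; exact hs2c) (fun _ _ => 0) hK0cl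
  obtain ⟨H1, H2, H3⟩ := h216
  obtain ⟨H10, H20, -⟩ := h2160
  choose ΨK hΨK using H1
  choose Ψ hΨ using H10
  choose BΨK hBΨK using fun c => (hΨK c).1
  choose BΨ hBΨ using fun c => (hΨ c).1
  have hΨKeq := fun c => (hΨK c).2.1
  have hΨeq : ∀ c p, ((n : ℝ) + 1) ^ 2 * ∑ μ', (2 * Ψ c p - Ψ c (p + e μ') - Ψ c (p - e μ'))
      + a / ((n : ℝ) + 1) ^ d * ∑ q ∈ B n (blk n p), Ψ c q + V p * Ψ c p = if blk n p = c then 1 else 0 := fun c p => by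
    have h := (hΨ c).2.1 p
    simp only [zero_mul, tsum_zero, add_zero] at h
    exact h
  -- (194): the inverse of the coarse operator; (219): the inverse of the perturbed coarse operator
  obtain ⟨M, hM, hMd, -⟩ := H194 n V hV hV' Ψ BΨ hBΨ hΨeq
  obtain ⟨N, hNd, hright, hleft, hNM, huniq⟩ := H219 n V hV hV' Ψ BΨ hBΨ hΨeq M hM ε γ μ ν hε hμ hμδb hμγ hν hνμ hνδb hs1b
    (by rw [hCPKb, hY] at hs2b; exact hs2b) (by rw [hCMb, hCPKb, hY] at hs3b; exact hs3b) K hK ΨK BΨK hBΨK hΨKeq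
  -- transport of the bounds to the merged constants
  have hexp : ∀ x : ℝ, 0 ≤ exp x := fun x => (exp_pos x).le
  refine ⟨Ψ, ΨK, M, N, hΨeq, fun c p => ?_, hΨKeq, fun c p => ?_, fun c p => ?_, fun b c => ?_, hM, fun b c => ?_,
    zd_coarse_inverse_symmetric hd a ha hlam hLam n V hV hV' Ψ BΨ hBΨ hΨeq M hM,
    fun b c => (zd_coarse_mul_inverse hd a ha hlam hLam n V hV hV' Ψ BΨ hBΨ hΨeq M hM b c).2,
    fun b c => (zd_coarse_inverse_mul hd a ha hlam hLam n V hV hV' Ψ BΨ hBΨ hΨeq M hM b c).2,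
    fun b c => ?_, hright, hleft, fun b c => ?_, huniq⟩
  · have h := (H20 c (Ψ c) (BΨ c) (hBΨ c) ((hΨ c).2.1)).1 p
    rw [← hCPKc] at h
    exact h.trans (mul_le_mul_of_nonneg_right (mul_le_mul_of_nonneg_left hleCPKc zero_le_two) (hexp _))
  · have h := (H2 c (ΨK c) (BΨK c) (hBΨK c) (hΨKeq c)).1 p
    rw [← hCPKc] at h
    exact h.trans (mul_le_mul_of_nonneg_right (mul_le_mul_of_nonneg_left hleCPKc zero_le_two) (hexp _))
  · have h := (H3 c (ΨK c) (BΨK c) (hBΨK c) (hΨKeq c) (Ψ c) (BΨ c) (hBΨ c) (hΨeq c)).1 p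
    rw [← hCPKc, ← hY] at h
    exact h.trans (mul_le_mul_of_nonneg_right hηc (hexp _))
  · have h := (H3 c (ΨK c) (BΨK c) (hBΨK c) (hΨKeq c) (Ψ c) (BΨ c) (hBΨ c) (hΨeq c)).2 b
    rw [← hCPKc, ← hY] at h
    exact h.trans (mul_le_mul_of_nonneg_right hηc (hexp _))
  · refine (hMd b c).trans (mul_le_mul (le_max_right _ _) (exp_le_exp.2 ?_) (hexp _) (by positivity))
    have h0 : (0 : ℝ) ≤ ∑ i, (((b i - c i).natAbs : ℕ) : ℝ) := by positivity
    exact neg_le_neg (mul_le_mul_of_nonneg_right (min_le_right _ _) h0)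
  · have h := hNd b c
    rw [← hCMb] at h
    exact h.trans (mul_le_mul_of_nonneg_right (mul_le_mul_of_nonneg_left hleCMb zero_le_two) (hexp _))
  · have h := hNM b c
    rw [← hCMb, ← hCPKb, ← hY] at h
    refine h.trans (mul_le_mul_of_nonneg_right ?_ (hexp _))
    exact mul_le_mul (mul_le_mul_of_nonneg_left hleCMb zero_le_two) (mul_le_mul hleCMb hLEb (by positivity) hCM0)
      (by positivity) (by positivity)

/-! ## §3. Toy -/

/-- Toy (`d = 2`): `K` is antitone — `K_2 ≤ K_1`. -/
example : (2 * (1 - exp (-(2 : ℝ)))⁻¹) ^ 2 ≤ (2 * (1 - exp (-(1 : ℝ)))⁻¹) ^ 2 := K_antitone (d := 2) one_pos one_le_two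

end Summit.QuantumFields.BalabanUV.T4Continuum.NE7b.SupZdPerturbedColumn
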